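import Mathlib
import HarnessLib
import Summits.Ventures.LatticeQCDFlow.StatementLocality
import Summits.Ventures.LatticeQCDFlow.TrivializingMaps.FisherStaircase
import Summits.Ventures.LatticeQCDFlow.TrivializingMaps.FisherStaircaseZeroSet
import Summits.Ventures.LatticeQCDFlow.TrivializingMaps.FisherStaircaseTight
import Summits.Ventures.LatticeQCDFlow.TrivializingMaps.WilsonActionFluctuates
import Summits.Ventures.LatticeQCDFlow.TrivializingMaps.FisherZeroNearCoupling
import Summits.Ventures.LatticeQCDFlow.TrivializingMaps.WilsonSU2FisherZeroRadius
import Summits.Ventures.LatticeQCDFlow.TrivializingMaps.HaarTraceMomentsSUn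

/-!
# Venture statement — LatticeQCDFlow — DRAFT, Part T10–T13: THE COUPLING-CONTINUATION STAIRCASE
# PAST THE FISHER ZEROS (AND THAT THERE ARE FISHER ZEROS TO PASS)

HONEST FRAMING: exact (Metropolis-corrected) sampling algorithms for lattice gauge theory;
figures of merit are autocorrelation/cost numbers at stated couplings and volumes; no
continuum-physics claim.

This file CONTINUES the venture's `Statement.lean` DRAFT (FANOUT-PLAN.md row 31, lean-2; review-queued;
it STAYS A DRAFT until the operator adopts it), after `StatementLocality.lean` (Parts T7–T9).  It is a
separate module only because `Statement.lean` has reached the tree's 400-line limit; on adoption the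
operator may merge the three.  As in Parts T–T9, every `Prop` below is a typed statement over the
landed substrate with a `_holds` theorem next to it, and
`TheoryStatementT13 := TheoryStatementT9 ∧ T10 ∧ T11 ∧ T12 ∧ T13` is PROVED.

The theory brief's question "what can be typed in Lean as cited statements vs what is conjecture;
no-go directions" receives here the theorem-level answer of theory-1's THEOREM S family (rows 92a–92e,
`TrivializingMaps/FisherStaircase*.lean`) for ONE continuation scheme — the perturbative STAIRCASE:
Lüscher's flow-constant series is the Taylor series at `s = 0` of `Z′/Z = -⟨S⟩_s`
(`Z(s) = ∫ D[U] e^{-sS}`, THEOREM F″); a staircase re-expands `Z′/Z` at successive real couplings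
`x₀ ≤ x₁ ≤ … ≤ x_K`, stage `k` being used with a margin `η ∈ (0,1)` (summable at
`x_k + Δ_k/(1-η)`, `Δ_k = x_{k+1} - x_k`).  For EVERY smooth action on `SU(n)^E`, EVERY periodic
volume and EVERY Fisher zero `s₀` of `Z_L`:

* **T10 (THEOREM S — the zeros price the staircase)** — `η^K·|x₀ - s₀| ≤ |x_K - s₀|`;
  `K·log(1/η) ≥ arsinh((x_K - Re s₀)/|Im s₀|) - arsinh((x₀ - Re s₀)/|Im s₀|)` (the quasihyperbolic
  length of `[x₀, x_K]` in `ℂ ∖ {s₀}`); and the several-zeros form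
  `K·log(1/η) ≥ ∫_{x₀}^{x_K} dt/dist(t, F_Z)`, `F_Z` the zero set
  (`Staircase.actionZ_pow_mul_dist_le`, `….actionZ_arsinh_sub_le` — row 92b;
  `….actionZ_integral_inv_infDist_le` — row 92d).
* **T11 (THEOREM S♯ — the law is two-sided)** — the greedy `θ`-staircase
  `x_{k+1} = x_k + (1-η)θ·dist(x_k, F_Z)` (`0 ≤ θ < 1`) EXISTS from every start, IS an `η`-margined
  admissible staircase (each stage provably summable where it is used), and PASSES every coupling `β`
  with `∫_{x₀}^{β} dt/dist(t, F_Z) < K·log(1 + (1-η)θ)` within `K` stages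
  (`Staircase.exists_greedyChain`, `….actionZ_greedy_admissible`, `….actionZ_greedy_passes` — row 92e).
* **T12 (one stage below the uniform radius, Wilson action)** — there is `ρ = ρ(d, n, B) > 0` such
  that for EVERY volume `L` the stage-`0` series (= Lüscher's flow-constant series,
  `Staircase.luscher_stage_zero`) sums to `Z_L′/Z_L` on `|s| < ρ`: below the volume-uniform zero-free
  radius of THEOREM A + F′ ONE stage serves every volume (`wilson_one_stage_of_uniform_radius` — row 92b).
* **T13 (there ARE Fisher zeros, Wilson action)** — for `d ≥ 2`, `n ≥ 2` and EVERY `L ≥ 2` the `SU(n)`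
  Wilson partition function `Z_L` has a zero `s₀`, necessarily off the real axis: T10–T11 are never
  vacuous for the theory the venture is about (lean-2's `wilson_exists_fisherZero`: the Wilson action has
  positive variance under `D[U]`, and a bounded observable with positive variance has a complex-MGF zero —
  Borel–Carathéodory + Schwarz, `FisherZerosExist` / `WilsonActionFluctuates`).

NOT part of the binding text (= theory-1's NOT-CLAIMED list, RT-30 (61)(a)/(65)): a lower bound on the
number of STAGES of THIS analytic-continuation scheme only — nothing about other schemes (resummations,
complex paths, non-perturbative or trained flows, annealing / sequential schemes with MCMC in between);
NO location of any Fisher zero is asserted for any `L` or `β` beyond what the tree proves (zero-freeness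
below the uniform radius); no cost / autocorrelation / continuum statement.
-/

namespace Summit.Ventures.LatticeQCDFlow

open MeasureTheory ProbabilityTheory Metric
open Literature.MathematicalPhysics.QuantumFieldTheory
open Literature.MathematicalPhysics.QuantumFieldTheory.Luscher2010
open Literature.MathematicalPhysics.QuantumFieldTheory.WilsonFlow (coeConfig)
open scoped Matrix Matrix.Norms.Frobenius ContDiff

section PartT10

/-- **T10 — THEOREM S: EVERY FISHER ZERO OF `Z_L` PRICES EVERY `η`-MARGINED STAIRCASE OF RE-EXPANDED
FLOW-CONSTANT SERIES** (geometric form, quasihyperbolic single-zero form, several-zeros length form),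
for every smooth action, every volume. -/
def T10_FisherStaircase : Prop :=
  ∀ (d L n : ℕ) [NeZero L] (S : AmbConfig d L n → ℝ), ContDiff ℝ ∞ S →
    ∀ (s₀ : ℂ), complexMGF (fun U => -S (coeConfig U))
        (trivialMeasure (Matrix.specialUnitaryGroup (Fin n) ℂ) d L) s₀ = 0 →
    ∀ (η : ℝ), 0 < η → η < 1 → ∀ (K : ℕ) (x : ℕ → ℝ), (∀ k < K, x k ≤ x (k + 1)) →
    (∀ k < K, Summable fun j : ℕ => (j.factorial : ℂ)⁻¹ *
      iteratedDeriv j (fun w => deriv (complexMGF (fun U => -S (coeConfig U))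
          (trivialMeasure (Matrix.specialUnitaryGroup (Fin n) ℂ) d L)) w /
        complexMGF (fun U => -S (coeConfig U))
          (trivialMeasure (Matrix.specialUnitaryGroup (Fin n) ℂ) d L) w) (x k) *
      (((x k + (x (k + 1) - x k) / (1 - η) : ℝ) : ℂ) - x k) ^ j) →
    η ^ K * ‖(x 0 : ℂ) - s₀‖ ≤ ‖(x K : ℂ) - s₀‖ ∧
    Real.arsinh ((x K - s₀.re) / |s₀.im|) - Real.arsinh ((x 0 - s₀.re) / |s₀.im|)
      ≤ K * Real.log (1 / η) ∧
    ∫ t in x 0..x K, (infDist (t : ℂ) {s : ℂ | complexMGF (fun U => -S (coeConfig U))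
        (trivialMeasure (Matrix.specialUnitaryGroup (Fin n) ℂ) d L) s = 0})⁻¹
      ≤ K * Real.log (1 / η)

/-- T10 holds (`Staircase.actionZ_pow_mul_dist_le`, `Staircase.actionZ_arsinh_sub_le`,
`Staircase.actionZ_integral_inv_infDist_le`). -/
theorem T10_FisherStaircase_holds : T10_FisherStaircase :=
  fun _ _ _ _ _ hS _ hz _ hη0 hη1 _ _ hmono hadm =>
    ⟨TrivializingMaps.Staircase.actionZ_pow_mul_dist_le hS hz hη0.le hη1 hmono hadm,
      TrivializingMaps.Staircase.actionZ_arsinh_sub_le hS hz hη0 hη1 hmono hadm,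
      TrivializingMaps.Staircase.actionZ_integral_inv_infDist_le hS hz hη0 hη1 hmono hadm⟩

/-- **T11 — THEOREM S♯: THE STAIRCASE LAW IS TWO-SIDED.**  The greedy `θ`-staircase w.r.t. the Fisher
zero set exists from every start, is an `η`-margined admissible staircase, and passes every coupling
`β` whose quasihyperbolic distance from `x₀` is `< K·log(1 + (1-η)θ)` within `K` stages. -/
def T11_GreedyStaircase : Prop :=
  ∀ (d L n : ℕ) [NeZero L] (S : AmbConfig d L n → ℝ), ContDiff ℝ ∞ S →
    ∀ (s₀ : ℂ), complexMGF (fun U => -S (coeConfig U))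
        (trivialMeasure (Matrix.specialUnitaryGroup (Fin n) ℂ) d L) s₀ = 0 →
    ∀ (η θ : ℝ), η < 1 → 0 ≤ θ → θ < 1 → ∀ (a : ℝ),
    (∃ x : ℕ → ℝ, x 0 = a ∧ ∀ k, x (k + 1) = x k + (1 - η) * θ * infDist (x k : ℂ) {s : ℂ |
      complexMGF (fun U => -S (coeConfig U))
        (trivialMeasure (Matrix.specialUnitaryGroup (Fin n) ℂ) d L) s = 0}) ∧
    ∀ (x : ℕ → ℝ), (∀ k, x (k + 1) = x k + (1 - η) * θ * infDist (x k : ℂ) {s : ℂ |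
      complexMGF (fun U => -S (coeConfig U))
        (trivialMeasure (Matrix.specialUnitaryGroup (Fin n) ℂ) d L) s = 0}) →
    (∀ k : ℕ, Summable fun j : ℕ => (j.factorial : ℂ)⁻¹ *
      iteratedDeriv j (fun w => deriv (complexMGF (fun U => -S (coeConfig U))
          (trivialMeasure (Matrix.specialUnitaryGroup (Fin n) ℂ) d L)) w /
        complexMGF (fun U => -S (coeConfig U))
          (trivialMeasure (Matrix.specialUnitaryGroup (Fin n) ℂ) d L) w) (x k) *
      (((x k + (x (k + 1) - x k) / (1 - η) : ℝ) : ℂ) - x k) ^ j) ∧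
    ∀ (K : ℕ) (β : ℝ),
      (∫ t in x 0..β, (infDist (t : ℂ) {s : ℂ | complexMGF (fun U => -S (coeConfig U))
          (trivialMeasure (Matrix.specialUnitaryGroup (Fin n) ℂ) d L) s = 0})⁻¹ <
        K * Real.log (1 + (1 - η) * θ)) →
      ∃ k ≤ K, β < x k

/-- T11 holds (`Staircase.exists_greedyChain`, `Staircase.actionZ_greedy_admissible`,
`Staircase.actionZ_greedy_passes`). -/
theorem T11_GreedyStaircase_holds : T11_GreedyStaircase :=
  fun _ _ _ _ _ hS _ hz _ _ hη1 hθ0 hθ1 a =>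
    ⟨TrivializingMaps.Staircase.exists_greedyChain _ a _, fun _ hx =>
      ⟨fun k => TrivializingMaps.Staircase.actionZ_greedy_admissible hS hz hη1 hθ0 hθ1 hx k,
        fun _ _ hlt => TrivializingMaps.Staircase.actionZ_greedy_passes hS hz hη1 hθ0 hx hlt⟩⟩

/-- **T12 — BELOW THE VOLUME-UNIFORM RADIUS ONE STAGE SERVES EVERY VOLUME (Wilson action).**  There is
`ρ > 0` depending only on `d, n` and the basis such that for every periodic volume `L` the stage-`0`
series of the `SU(n)` Wilson partition function `Z_L` sums to `Z_L′/Z_L` at every `|s| < ρ`. -/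
def T12_OneStageUniformRadius : Prop :=
  ∀ (d n : ℕ) (B : SuBasis n), ∃ ρ : ℝ, 0 < ρ ∧ ∀ (L : ℕ) [NeZero L] (s : ℂ), ‖s‖ < ρ →
    HasSum (fun k : ℕ => (k.factorial : ℂ)⁻¹ *
      iteratedDeriv k (fun w => deriv (complexMGF
          (fun U => -TrivializingMaps.ambWilsonAction (coeConfig U))
          (trivialMeasure (Matrix.specialUnitaryGroup (Fin n) ℂ) d L)) w /
        complexMGF (fun U => -TrivializingMaps.ambWilsonAction (coeConfig U))
          (trivialMeasure (Matrix.specialUnitaryGroup (Fin n) ℂ) d L) w) 0 * (s - 0) ^ k)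
      (deriv (complexMGF (fun U => -TrivializingMaps.ambWilsonAction (coeConfig U))
          (trivialMeasure (Matrix.specialUnitaryGroup (Fin n) ℂ) d L)) s /
        complexMGF (fun U => -TrivializingMaps.ambWilsonAction (coeConfig U))
          (trivialMeasure (Matrix.specialUnitaryGroup (Fin n) ℂ) d L) s)

/-- T12 holds (`TrivializingMaps.wilson_one_stage_of_uniform_radius`). -/
theorem T12_OneStageUniformRadius_holds : T12_OneStageUniformRadius :=
  fun d n B => TrivializingMaps.wilson_one_stage_of_uniform_radius d n B

/-- **T13 — THE FINITE-VOLUME `SU(n)` WILSON PARTITION FUNCTION HAS FISHER ZEROS** (`d ≥ 2`, `n ≥ 2`,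
every `L ≥ 2`), all of them off the real coupling axis. -/
def T13_WilsonFisherZerosExist : Prop :=
  ∀ (d L n : ℕ) [NeZero L], 2 ≤ d → 2 ≤ n → 2 ≤ L →
    ∃ s₀ : ℂ, complexMGF (fun U => -TrivializingMaps.ambWilsonAction (coeConfig U))
        (trivialMeasure (Matrix.specialUnitaryGroup (Fin n) ℂ) d L) s₀ = 0 ∧ s₀.im ≠ 0

/-- T13 holds (`TrivializingMaps.wilson_exists_fisherZero`, `TrivializingMaps.im_ne_zero_of_actionZ_eq_zero`). -/
theorem T13_WilsonFisherZerosExist_holds : T13_WilsonFisherZerosExist := by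
  intro d L n _ hd hn hL
  obtain ⟨s₀, hs₀⟩ := TrivializingMaps.wilson_exists_fisherZero (d := d) (L := L) (n := n) hd hn hL
  exact ⟨s₀, hs₀, TrivializingMaps.im_ne_zero_of_actionZ_eq_zero
    TrivializingMaps.contDiff_ambWilsonAction hs₀⟩

end PartT10

/-- **The theory conjunction with the staircase theorems** (DRAFT):
`TheoryStatementT9 ∧ T10 ∧ T11 ∧ T12 ∧ T13`. -/
def TheoryStatementT13 : Prop :=
  TheoryStatementT9 ∧ T10_FisherStaircase ∧ T11_GreedyStaircase ∧ T12_OneStageUniformRadius ∧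
    T13_WilsonFisherZerosExist

/-- The extended theory conjunction holds. -/
theorem TheoryStatementT13_holds : TheoryStatementT13 :=
  ⟨TheoryStatementT9_holds, T10_FisherStaircase_holds, T11_GreedyStaircase_holds,
    T12_OneStageUniformRadius_holds, T13_WilsonFisherZerosExist_holds⟩

/-! ### Appended (lean-2 GEN-6, second pass): Part T14–T15 — WHERE the Fisher zeros are

* **T14 (a zero near any coupling where the action fluctuates; short stages there)** — for every
  smooth action `S` with `|S∘ι| ≤ b`, every real coupling `x` and `R > 0`: if the ensemble
  `𝒵⁻¹e^{-xS}D[U]` has `Var(S∘ι) > 128(|b|R + 1)/R²` then `Z` has a zero `s₀` with `|s₀ - x| < R`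
  (`TrivializingMaps.exists_actionZ_eq_zero_near_of_variance_gt`; with T10 every `η`-margined stage
  centred at `x` is then shorter than `(1-η)R`).
* **T15 (volume-uniform zero and radius cap, Wilson action)** — with
  `m₂(n) = ∫_{SU(n)} (Re tr)² dHaar`: for every `d ≥ 2`, `n ≥ 2` and EVERY `L ≥ 2` the `SU(n)` Wilson
  partition function has a zero with `|s₀| < max 1 (256(2n+1)/m₂(n))`; EXPLICITLY `|s₀| < 1280` for
  `SU(2)` (`m₂ = 1`) and `|s₀| < 512(2n+1)` for `SU(n)`, `n ≥ 3` (`m₂ = ½`, Haar second moments of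
  the trace without Peter–Weyl), and every THEOREM-A volume-uniform radius obeys the same bounds
  (`TrivializingMaps.wilson_exists_fisherZero_norm_lt_uniform`, `….wilson_su2_exists_fisherZero_norm_lt`,
  `….wilson_su2_theoremA_radius_le`, `….wilson_sun_exists_fisherZero_norm_lt`,
  `….wilson_sun_theoremA_radius_le`).  NOT binding: any sharper location (printed zeros sit at
  `|s| ≈ 1`). -/

section PartT14

/-- **T14 — A LARGE ACTION VARIANCE AT COUPLING `x` FORCES A FISHER ZERO WITHIN `R` OF `x`** (every
smooth action, every volume). -/
def T14_FisherZeroNearCoupling : Prop :=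
  ∀ (d L n : ℕ) [NeZero L] (S : AmbConfig d L n → ℝ), ContDiff ℝ ∞ S → ∀ (b : ℝ),
    (∀ U : GaugeConfig d L (Matrix.specialUnitaryGroup (Fin n) ℂ), |S (coeConfig U)| ≤ b) →
    ∀ (x R : ℝ), 0 < R →
    128 * (|b| * R + 1) / R ^ 2 < variance (fun U => S (coeConfig U))
      (boltzmannMeasure fun U : GaugeConfig d L (Matrix.specialUnitaryGroup (Fin n) ℂ) =>
        x * S (coeConfig U)) →
    ∃ s₀ : ℂ, ‖s₀ - x‖ < R ∧ complexMGF (fun U => -S (coeConfig U))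
      (trivialMeasure (Matrix.specialUnitaryGroup (Fin n) ℂ) d L) s₀ = 0

/-- T14 holds (`TrivializingMaps.exists_actionZ_eq_zero_near_of_variance_gt`). -/
theorem T14_FisherZeroNearCoupling_holds : T14_FisherZeroNearCoupling :=
  fun _ _ _ _ _ hS _ hb x _ hR hvar =>
    TrivializingMaps.exists_actionZ_eq_zero_near_of_variance_gt hS hb x hR hvar

/-- **T15 — THE FINITE-VOLUME FISHER ZEROS OF THE WILSON THEORY STAY IN ONE DISC** (`SU(n)`, every
`L ≥ 2`, radius `max 1 (256(2n+1)/m₂(n))`), **explicitly `|s₀| < 1280` for `SU(2)` and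
`|s₀| < 512(2n+1)` for `SU(n)`, `n ≥ 3`, with the same bounds on every THEOREM-A volume-uniform
radius.** -/
def T15_WilsonUniformFisherZeroRadius : Prop :=
  (∀ (d L n : ℕ) [NeZero L], 2 ≤ d → 2 ≤ n → 2 ≤ L →
    ∃ s₀ : ℂ, ‖s₀‖ < max 1 (256 * (2 * n + 1) /
        ∫ g, ((g : Matrix (Fin n) (Fin n) ℂ)).trace.re ^ 2
          ∂(haarProbability (Matrix.specialUnitaryGroup (Fin n) ℂ))) ∧
      complexMGF (fun U => -TrivializingMaps.ambWilsonAction (coeConfig U))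
        (trivialMeasure (Matrix.specialUnitaryGroup (Fin n) ℂ) d L) s₀ = 0) ∧
  (∀ (d L : ℕ) [NeZero L], 2 ≤ d → 2 ≤ L →
    ∃ s₀ : ℂ, ‖s₀‖ < 1280 ∧
      complexMGF (fun U => -TrivializingMaps.ambWilsonAction (coeConfig U))
        (trivialMeasure (Matrix.specialUnitaryGroup (Fin 2) ℂ) d L) s₀ = 0) ∧
  (∀ (d : ℕ), 2 ≤ d → ∀ (ρ C : ℝ), 0 < ρ →
    (∀ (L : ℕ) [NeZero L] (B : SuBasis 2) (Sk : ℕ → AmbConfig d L 2 → ℝ) (c : ℕ → ℝ),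
      (∀ k, ContDiff ℝ ∞ (Sk k)) → IsLuscherSeries B TrivializingMaps.ambWilsonAction Sk c →
      ∀ (k : ℕ) (U : GaugeConfig d L (Matrix.specialUnitaryGroup (Fin 2) ℂ)) (e : Edge d L)
        (a : B.ι), |linkDeriv e (B.T a) (Sk k) (coeConfig U)| ≤ C * ρ⁻¹ ^ k) →
    SuBasis 2 → ρ ≤ 1280) ∧
  (∀ (d L n : ℕ) [NeZero L], 2 ≤ d → 3 ≤ n → 2 ≤ L →
    ∃ s₀ : ℂ, ‖s₀‖ < 512 * (2 * n + 1) ∧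
      complexMGF (fun U => -TrivializingMaps.ambWilsonAction (coeConfig U))
        (trivialMeasure (Matrix.specialUnitaryGroup (Fin n) ℂ) d L) s₀ = 0) ∧
  (∀ (d n : ℕ), 2 ≤ d → 3 ≤ n → ∀ (ρ C : ℝ), 0 < ρ →
    (∀ (L : ℕ) [NeZero L] (B : SuBasis n) (Sk : ℕ → AmbConfig d L n → ℝ) (c : ℕ → ℝ),
      (∀ k, ContDiff ℝ ∞ (Sk k)) → IsLuscherSeries B TrivializingMaps.ambWilsonAction Sk c →
      ∀ (k : ℕ) (U : GaugeConfig d L (Matrix.specialUnitaryGroup (Fin n) ℂ)) (e : Edge d L)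
        (a : B.ι), |linkDeriv e (B.T a) (Sk k) (coeConfig U)| ≤ C * ρ⁻¹ ^ k) →
    SuBasis n → ρ ≤ 512 * (2 * n + 1))

/-- T15 holds (`TrivializingMaps.wilson_exists_fisherZero_norm_lt_uniform`,
`TrivializingMaps.wilson_su2_exists_fisherZero_norm_lt`, `TrivializingMaps.wilson_su2_theoremA_radius_le`,
`TrivializingMaps.wilson_sun_exists_fisherZero_norm_lt`, `TrivializingMaps.wilson_sun_theoremA_radius_le`). -/
theorem T15_WilsonUniformFisherZeroRadius_holds : T15_WilsonUniformFisherZeroRadius :=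
  ⟨fun _ _ _ _ hd hn hL => TrivializingMaps.wilson_exists_fisherZero_norm_lt_uniform hd hn hL,
    fun _ _ _ hd hL => TrivializingMaps.wilson_su2_exists_fisherZero_norm_lt hd hL,
    fun _ hd _ _ hρ hA B => TrivializingMaps.wilson_su2_theoremA_radius_le hd hρ hA B,
    fun _ _ _ _ hd hn hL => TrivializingMaps.wilson_sun_exists_fisherZero_norm_lt hd hn hL,
    fun _ _ hd hn _ _ hρ hA B => TrivializingMaps.wilson_sun_theoremA_radius_le hd hn hρ hA B⟩

end PartT14

/-- **The theory conjunction with the zero-location theorems** (DRAFT):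
`TheoryStatementT13 ∧ T14 ∧ T15`. -/
def TheoryStatementT15 : Prop :=
  TheoryStatementT13 ∧ T14_FisherZeroNearCoupling ∧ T15_WilsonUniformFisherZeroRadius

/-- The extended theory conjunction holds. -/
theorem TheoryStatementT15_holds : TheoryStatementT15 :=
  ⟨TheoryStatementT13_holds, T14_FisherZeroNearCoupling_holds, T15_WilsonUniformFisherZeroRadius_holds⟩

end Summit.Ventures.LatticeQCDFlow
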